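import Summits.SmoothPoincare4.SmoothPoincare4.Theses.RicciFat
import HarnessLib

/-!
# Line `birth` — BC3 skeleton for the crux `RicciFat.RicciFatSphere` (stmt-SmoothPoincare4-5192)

Route `route-SmoothPoincare4-RicciFat` (rank-3 crux, the thesis `X` of the route), decl
`Summit.SmoothPoincare4.SmoothPoincare4.Theses.RicciFat.RicciFatSphere`:

  every closed smooth `M ≃ₕ S⁴` (Hausdorff, second countable, `C^∞` atlas on `ℝ⁴`, compact, Borel)
  carries, for every `δ > 0`, a `C^∞` Riemannian metric `h` (with its Levi-Civita connection) with
  `Ric_h ≥ 3h` and `Vol(M, h) ≥ (1 − δ)·8π²/3` — "`V(M) := sup{Vol : Ric ≥ 3} = Vol(S⁴)`".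

Standing of the crux (item notes 2026-08-15/16): `SmoothPoincare4 → RicciFatSphere` is PROVED
(`Theorems/RicciFatSpc4ImpliesRicciFatSphere.lean`, the round metric pulled back), and
`RicciFatSphere → SmoothPoincare4` holds modulo the vendored Cheeger–Colding fact
(`VolumeSphereRecognition` = `CheegerColding1997_thmA110.dim_four`; the route's `closes`). No
`Disproof.lean`, no landed `Theorems/RicciFatSphere/Negative/*`, negatives index of the summit empty
(2026-08-17).

## The line: the FILL-IN FORM of Ricci-fatness (route header, Two-layer plan (b); card
`ricci-fat-homotopy-balls` item 2), typed over the landed definition request D1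
(`Literature.Geometry.Riemannian.IsAdmissibleFillIn`, `HasRicciLowerBound`) and the tree's gluing
vocabulary (`Literature.Topology.FourManifolds.IsBoundaryGluing`, `closedBallBoundaryData 3`)

Write a homotopy 4-sphere as `M = 𝔻⁴ ∪_φ Δ` (a closed 4-ball glued to a compact CONTRACTIBLE `Δ` with
`∂Δ ≅ S³`). The round `S⁴` is `B_{ρ₀} ∪ B_{π−ρ₀}`: a small geodesic cap `B_{ρ₀}` (boundary the round
`S³(sin ρ₀)`, second fundamental form `II = +cot ρ₀ · g` for the outer normal) and the big cap
`B_{π−ρ₀}` (same boundary, `II = −cot ρ₀ · g`, volume `V(ρ₀) = 2π²(2/3 + cos ρ₀ − cos³ρ₀/3)`), with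
`Vol(B_{ρ₀}) + V(ρ₀) = 8π²/3`. An ADMISSIBLE FILL-IN of parameters `(sin ρ₀, −cot ρ₀)` on `Δ` is a
Riemannian metric whose boundary is round of radius `sin ρ₀` with `II ≥ −cot ρ₀ · g|∂Δ`
(Hang–Wang 2009 conventions; `IsAdmissibleFillIn`, AdmissibleFillIn.lean) — exactly the data under
which Perelman's gluing lemma (Perelman 1997, §4; Burdick 2019, Lemma 1.2: boundaries isometric and
`II₁ + II₂ ≥ 0`) lets one glue `Δ` to the small round cap keeping the Ricci lower bound up to a
smoothing loss. So the crux splits into three named statements, exactly one of which carries the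
open geometric content:

* `stub_ballSplitting` — TOPOLOGY (known; L in Lean): every closed smooth `M ≃ₕ S⁴` is a boundary
  gluing `𝔻⁴ ∪_φ Δ` with `Δ` a compact contractible smooth 4-manifold with boundary and
  `φ : S³ = ∂𝔻⁴ ≅ ∂Δ`. The splitting `M = 𝔻⁴ ∪_φ Δ` with `Δ` compact is the tree THEOREM
  `Literature.Topology.FourManifolds.exists_isBoundaryGluing_closedBall` (Milnor's Morse-theoretic
  disc, stated with `ULift 𝔻⁴`; here in universe `0` without the lift); contractibility of `Δ` is the
  homotopy computation `π₁(Δ) = 1` (van Kampen across `S³`), `H̃_*(Δ) = 0` (Mayer–Vietoris), Whitehead.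
  Sources: Milnor1963 §3; Kosinski1993 VI.1–2; Hatcher2002 Prop. 3.29/Cor. 4.33.
* `stub_ricciFatBall` — THE BET (the crux's open content in fill-in form, "`V_fill(Δ, ρ₀) = V(ρ₀)`"):
  every compact contractible smooth `Δ` with `∂Δ ≅ S³` admits, for each `ρ₀ ∈ (0, π/2)` and each
  `ε > 0`, a `C^∞` Riemannian metric with `Ric ≥ 3`, admissible of parameters `(sin ρ₀, −cot ρ₀)`,
  and `Vol ≥ V(ρ₀) − ε`. True on `Δ ≅ 𝔻⁴` (the big cap itself); by Heintze–Karcher / Kasue every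
  admissible fill-in has `Vol ≤ V(ρ₀)` (equality iff the cap), so the stub says the KNOWN upper bound
  is approached on every contractible `Δ`. Why it might fail: an exotic `Σ = 𝔻⁴ ∪ Δ` makes it false
  for that `Δ` (stubs 1, 3 + Cheeger–Colding A.1.10); near-extremal fill-ins are GH-close to the cap
  at every scale (Bishop–Gromov with boundary, Perales 2016), so a witness on a non-ball `Δ` must hide
  its topology in a volume-negligible, curvature-concentrating region — the same tension as the crux,
  now localised on a FIXED compact contractible piece with controlled boundary (explicit Mazur /
  Akbulut handlebodies `0h ∪ 1h ∪ 2h` are the test cases). Sources: Perelman1997BigVolume §4,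
  HangWang2009 Thms 2–3, HeintzeKarcher1978 §3, Kasue1983 Thm A, Perales2016, CheegerColding1997.
* `stub_capGluing` — ANALYSIS + `Γ₄ = 0` (known modulo pinning one quantitative rider; L): if
  `M = 𝔻⁴ ∪_φ Δ` (any closed smooth `M`, any compact `Δ`, any `φ`) and `Δ` carries, for every `ε > 0`,
  an admissible `(sin ρ₀, −cot ρ₀)` fill-in metric with `Ric ≥ 3` and `Vol ≥ V(ρ₀) − ε`, then `M` is
  Ricci-fat: for every `δ > 0` a `C^∞` metric on `M` with `Ric ≥ 3` and `Vol ≥ (1 − δ)·8π²/3`.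
  Proof in print: glue the small round cap `B_{ρ₀}` (`II = cot ρ₀`) to `(Δ, h_ε)` along the boundary
  isometry — `II_Δ + II_cap ≥ 0` — by Perelman's `C⁰`-gluing and mollify (Perelman 1997 §4 / Burdick
  2019 Lemma 1.2 / Kapovitch–Ketterer–Sturm 2023 for the synthetic `RCD(3−η, 4)` form) to a smooth
  metric with `Ric ≥ 3 − η` and `Vol ≥ V(ρ₀) − ε + Vol(B_{ρ₀}) − η = 8π²/3 − ε − η`; rescale by
  `λ² = (3 − η)/3` (`Ric` is scale invariant, `Vol ↦ λ⁴ Vol`); the glued manifold is `𝔻⁴ ∪_{φ'} Δ` for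
  the identification `φ'` read off the boundary isometry, and `𝔻⁴ ∪_{φ'} Δ ≅ 𝔻⁴ ∪_φ Δ = M` because every
  diffeomorphism of `S³` extends over `𝔻⁴` (Cerf 1968, `Γ₄ = 0`: tree named fact
  `Literature.Topology.FourManifolds.cerf_twistedSphere_four` / `cerf_diffeomorph_sphere_three_extends_ball`,
  with gluing uniqueness `nonempty_diffeomorph_of_isBoundaryGluing_holds`, PROVED); finally transport the
  metric along that diffeomorphism (naturality of `Ric` and of the Riemannian measure, as in
  `Theorems/EntropyRungSubcylindricalExistenceTransport.exists_roundMetric_transport`, PROVED pattern).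
  The rider "collar smoothing keeps `Ric ≥ κ − η` with volume loss `→ 0`" is the one flagged
  open-to-pin in the route header (F3). Why it might fail: only through that rider (the `C⁰` seam has
  distributional `Ric ≥ 0` across it by `II₁ + II₂ ≥ 0`; Perelman's smoothing is stated for `Ric > 0`,
  the `Ric ≥ κ − η` bookkeeping is folklore — Burdick 2019 §2, Schlichting 2012 — but unprinted in this
  exact form). Sources: Perelman1997BigVolume, Burdick2019, KapovitchKettererSturm2023, Cerf1968,
  HirschDT1976 Ch. 8 Thm 2.1.
* `RicciFatSphere_of_stubSigs : stub₁-sig → stub₂-sig → stub₃-sig → RicciFatSphere` — the REAL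
  composition (sorry-free): split `M = 𝔻⁴ ∪_φ Δ` (stub 1), give `Δ` its Borel σ-algebra, feed the
  near-extremal fill-ins of stub 2 at `ρ₀ = π/4` (`∂Δ ≅ S³` witnessed by `φ⁻¹`) into stub 3.
* `RicciFatSphere_of : RicciFatSphere` — THE skeleton theorem: the crux BY NAME from the three
  declared stubs (the only `sorry`s of the file).

Logical status: `SPC4 ⇒` each stub (stub 1, 3 are theorems-in-print; stub 2 on `Δ ≅ 𝔻⁴` is the big
cap); stubs `⇒` crux (this file); crux `⇒ SPC4` modulo `VolumeSphereRecognition` (route `closes`);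
hence stub 2 is `⇔ SPC4` modulo known theorems — as every statement on this route must be (the thesis
`X` is `⇔ SPC4` modulo Cheeger–Colding 1997) — but it is NOT cheaply the crux or the summit: it speaks
of metrics WITH BOUNDARY DATA on a fixed compact contractible `Δ`, never of a closed manifold.
BC3 probes (planner folder `bc/probe_*.lean`, 2026-08-17): for each stub, `stub → RicciFatSphere` and
`stub → SmoothPoincare4` by `first | exact? | simpa | aesop` FAIL. Disproof used: none exists for this
crux (`ledger crux ls stmt-SmoothPoincare4-5192`: no workfiles at registration); negatives index empty.
The alternative line of the route header (Two-layer plan (a): cork presentation + τ-symmetric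
almost-round metric on `S⁴` + isometric regluing) is NOT this file; its typing template is
`Cruxes/CorkRegluablePsc/Lines/birth.lean` (route WeylBudget).
-/

noncomputable section

open scoped Manifold ContDiff Topology ENNReal
open ContinuousMap
open Literature.Geometry.Lorentzian (PseudoRiemannianMetric riemannianMeasure)
open Literature.Geometry.Riemannian (HasRicciLowerBound IsAdmissibleFillIn)
open Literature.Topology.FourManifolds
open Summit.SmoothPoincare4.SmoothPoincare4.Theses.RicciFat (RicciFatSphere)

-- `Summit.<Summit>.<Problem>`: for the single-conjunct summit the duplicate segment is mandated.
set_option linter.dupNamespace false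
set_option linter.unusedVariables false

namespace Summit.SmoothPoincare4.SmoothPoincare4.Cruxes.RicciFatSphere.Birth

/-! ## The three registered stubs (`sorry` lives ONLY here) -/

/-- **Stub 1 (KNOWN — topology): a homotopy 4-sphere is a closed 4-ball glued to a compact
contractible piece.** For every closed smooth `M ≃ₕ S⁴` (the crux's carriers) there are a compact
contractible `C^∞` 4-manifold with boundary `Δ` (Hausdorff, second countable, half-space atlas), a
boundary datum `b` of `Δ` and a diffeomorphism `φ : S³ = ∂𝔻⁴ ≅ ∂Δ` with `M = 𝔻⁴ ∪_φ Δ`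
(`IsBoundaryGluing (closedBallBoundaryData 3) b φ (𝓡 4) M`). The gluing is the tree theorem
`exists_isBoundaryGluing_closedBall` (Milnor 1963 §3: the sublevel set below the second critical
value of a generic Morse function is a disc) transported from `ULift 𝔻⁴` to `𝔻⁴`; `Δ` is
contractible because `M ≃ₕ S⁴`: `π₁(Δ) = π₁(M) = 1` (van Kampen across the collared `S³`),
`H̃_*(Δ) = 0` (Mayer–Vietoris for `M = 𝔻⁴ ∪ Δ`, `H_*(M) = H_*(S⁴)`), Whitehead's theorem.
Size L (the homotopy computation over Mathlib's singular homology is the long part).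
[cite: Milnor1963, §3 and proof of Thm. 4.1] [cite: Hatcher2002, Prop. 3.29, Cor. 4.33] -/
theorem stub_ballSplitting :
    ∀ (M : Type) [TopologicalSpace M] [T2Space M] [SecondCountableTopology M]
      [ChartedSpace (EuclideanSpace ℝ (Fin 4)) M] [IsManifold (𝓡 4) ∞ M] [CompactSpace M],
      M ≃ₕ Metric.sphere (0 : EuclideanSpace ℝ (Fin 5)) 1 →
        ∃ (Δ : Type) (_ : TopologicalSpace Δ) (_ : T2Space Δ) (_ : SecondCountableTopology Δ)
          (_ : ChartedSpace (EuclideanHalfSpace 4) Δ) (_ : IsManifold (𝓡∂ 4) ∞ Δ)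
          (b : BoundaryData (𝓡∂ 4) Δ (𝓡 3))
          (φ : (closedBallBoundaryData 3).carrier ≃ₘ⟮𝓡 3, 𝓡 3⟯ b.carrier),
          CompactSpace Δ ∧ ContractibleSpace Δ ∧
            IsBoundaryGluing (closedBallBoundaryData 3) b φ (𝓡 4) M := by
  sorry

/-- **Stub 2 (OPEN — the bet, "Ricci-fat homotopy balls", fill-in form of the thesis): near-extremal
admissible fill-ins exist on every compact contractible `Δ` with `∂Δ ≅ S³`.** For every compact
contractible `C^∞` 4-manifold with boundary `Δ` (Hausdorff, second countable, Borel σ-algebra) with a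
boundary datum `b` whose boundary 3-manifold is diffeomorphic to `S³`, every `ρ₀ ∈ (0, π/2)` and
every `ε > 0`, there is a `C^∞` Riemannian metric `h` on `TΔ` (with its Levi-Civita connection) with
`Ric_h ≥ 3h` (`HasRicciLowerBound … 3`), ADMISSIBLE of parameters `(sin ρ₀, −cot ρ₀)`
(`IsAdmissibleFillIn`: `(∂Δ, h|∂Δ)` isometric to the round `S³(sin ρ₀)` and `II ≥ −cot ρ₀ · h|∂Δ` for
the outer unit normal, Hang–Wang's `Π(X,Y) = ⟨∇_X ν, Y⟩`), and
`Vol(Δ, h) ≥ V(ρ₀) − ε`, `V(ρ₀) = Vol_{S⁴}(B_{π−ρ₀}) = 2π²(2/3 + cos ρ₀ − cos³ρ₀/3)` — the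
Heintze–Karcher/Kasue upper bound for admissible fill-ins, attained by the big cap on `Δ ≅ 𝔻⁴`.
Why it might fail: false for the `Δ` of an exotic `Σ = 𝔻⁴ ∪ Δ` (stubs 1, 3 and Cheeger–Colding
A.1.10); a near-extremal fill-in is GH-close to the cap at all scales (volume cone rigidity with
boundary), so only an almost-isometry of most of `Δ` with most of the cap can witness it.
Size: open problem (the crux's own content, localised on a fixed compact piece with boundary
control). [cite: Perelman1997BigVolume, §4] [cite: HangWang2009, Thms. 2–3]
[cite: HeintzeKarcher1978, §3] [cite: Kasue1983, Thm. A] -/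
theorem stub_ricciFatBall :
    ∀ (Δ : Type) [TopologicalSpace Δ] [T2Space Δ] [SecondCountableTopology Δ]
      [ChartedSpace (EuclideanHalfSpace 4) Δ] [IsManifold (𝓡∂ 4) ∞ Δ] [CompactSpace Δ]
      [ContractibleSpace Δ] [MeasurableSpace Δ] [BorelSpace Δ]
      (b : BoundaryData (𝓡∂ 4) Δ (𝓡 3)),
      Nonempty (b.carrier ≃ₘ⟮𝓡 3, 𝓡 3⟯ Metric.sphere (0 : EuclideanSpace ℝ (Fin 4)) 1) →
      ∀ ρ₀ : ℝ, 0 < ρ₀ → ρ₀ < Real.pi / 2 → ∀ ε : ℝ, 0 < ε →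
        ∃ h : Bundle.ContMDiffRiemannianMetric (𝓡∂ 4) ∞ (EuclideanSpace ℝ (Fin 4))
            (TangentSpace (𝓡∂ 4) : Δ → Type _),
          ∃ _ : (PseudoRiemannianMetric.ofRiemannian h).HasLeviCivita,
            HasRicciLowerBound (PseudoRiemannianMetric.ofRiemannian h) 3 ∧
            IsAdmissibleFillIn (PseudoRiemannianMetric.ofRiemannian h) b (Real.sin ρ₀) (-Real.cot ρ₀) ∧
            ENNReal.ofReal (2 * Real.pi ^ 2 * (2 / 3 + Real.cos ρ₀ - Real.cos ρ₀ ^ 3 / 3) - ε) ≤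
              riemannianMeasure h Set.univ := by
  sorry

/-- **Stub 3 (KNOWN modulo one flagged rider — comparison geometry + `Γ₄ = 0`): closing a
near-extremally fillable piece by a round cap gives a Ricci-fat closed manifold.** Let the closed
smooth 4-manifold `M` (the crux's carriers) be a boundary gluing `𝔻⁴ ∪_φ Δ` of the closed unit
4-ball and a compact `C^∞` 4-manifold with boundary `Δ` (boundary datum `b`, `φ : S³ ≅ ∂Δ`), let
`ρ₀ ∈ (0, π/2)`, and suppose `Δ` carries for every `ε > 0` a `C^∞` Riemannian metric with
`Ric ≥ 3`, admissible of parameters `(sin ρ₀, −cot ρ₀)` and of volume `≥ V(ρ₀) − ε`. Then for every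
`δ > 0` there is a `C^∞` Riemannian metric `h'` on `M` (with its Levi-Civita connection) with
`Ric_{h'} ≥ 3h'` and `Vol(M, h') ≥ (1 − δ)·8π²/3`. Proof in print: glue the small round cap
`B_{ρ₀} ⊂ S⁴` (boundary `S³(sin ρ₀)`, `II = cot ρ₀`) to `(Δ, h_ε)` along the boundary isometry —
`II_Δ + II_cap ≥ 0` — (Perelman 1997 §4; Burdick 2019 Lemma 1.2), mollify the `C⁰` seam keeping
`Ric ≥ 3 − η` with volume loss `≤ η` (the rider F3 of the route header; synthetic form
Kapovitch–Ketterer–Sturm 2023), so `Vol ≥ 8π²/3 − ε − 2η` since `Vol(B_{ρ₀}) + V(ρ₀) = 8π²/3`;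
rescale by `λ² = (3−η)/3`; identify the glued manifold `𝔻⁴ ∪_{φ'} Δ` with `M = 𝔻⁴ ∪_φ Δ` by Cerf's
`Γ₄ = 0` (every diffeomorphism of `S³` extends over `𝔻⁴`; tree named fact
`cerf_diffeomorph_sphere_three_extends_ball`, gluing uniqueness
`nonempty_diffeomorph_of_isBoundaryGluing_holds` PROVED) and transport the metric (naturality of
`Ric` and of `riemannianMeasure` under isometric diffeomorphisms, the proved pattern of
`exists_roundMetric_transport`). No hypothesis on the topology of `Δ` is needed. Why it might
fail: only via the smoothing rider (unprinted in the exact `Ric ≥ κ − η`, `ΔVol → 0` form).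
Size L. [cite: Perelman1997BigVolume, §4] [cite: Burdick2019, Lemma 1.2]
[cite: KapovitchKettererSturm2023] [cite: Cerf1968, Γ₄ = 0] [cite: HirschDT1976, Ch. 8 Thm. 2.1] -/
theorem stub_capGluing :
    ∀ (M : Type) [TopologicalSpace M] [T2Space M] [SecondCountableTopology M]
      [ChartedSpace (EuclideanSpace ℝ (Fin 4)) M] [IsManifold (𝓡 4) ∞ M] [CompactSpace M]
      [MeasurableSpace M] [BorelSpace M]
      (Δ : Type) [TopologicalSpace Δ] [T2Space Δ] [SecondCountableTopology Δ]
      [ChartedSpace (EuclideanHalfSpace 4) Δ] [IsManifold (𝓡∂ 4) ∞ Δ] [CompactSpace Δ]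
      [MeasurableSpace Δ] [BorelSpace Δ]
      (b : BoundaryData (𝓡∂ 4) Δ (𝓡 3))
      (φ : (closedBallBoundaryData 3).carrier ≃ₘ⟮𝓡 3, 𝓡 3⟯ b.carrier),
      IsBoundaryGluing (closedBallBoundaryData 3) b φ (𝓡 4) M →
      ∀ ρ₀ : ℝ, 0 < ρ₀ → ρ₀ < Real.pi / 2 →
        (∀ ε : ℝ, 0 < ε →
          ∃ h : Bundle.ContMDiffRiemannianMetric (𝓡∂ 4) ∞ (EuclideanSpace ℝ (Fin 4))
              (TangentSpace (𝓡∂ 4) : Δ → Type _),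
            ∃ _ : (PseudoRiemannianMetric.ofRiemannian h).HasLeviCivita,
              HasRicciLowerBound (PseudoRiemannianMetric.ofRiemannian h) 3 ∧
              IsAdmissibleFillIn (PseudoRiemannianMetric.ofRiemannian h) b (Real.sin ρ₀) (-Real.cot ρ₀) ∧
              ENNReal.ofReal (2 * Real.pi ^ 2 * (2 / 3 + Real.cos ρ₀ - Real.cos ρ₀ ^ 3 / 3) - ε) ≤
                riemannianMeasure h Set.univ) →
        ∀ δ : ℝ, 0 < δ →
          ∃ h' : Bundle.ContMDiffRiemannianMetric (𝓡 4) ∞ (EuclideanSpace ℝ (Fin 4))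
              (TangentSpace (𝓡 4) : M → Type _),
            ∃ _ : (PseudoRiemannianMetric.ofRiemannian h').HasLeviCivita,
              (∀ (x : M) (v : TangentSpace (𝓡 4) x),
                3 * h'.inner x v v ≤ (PseudoRiemannianMetric.ofRiemannian h').ricci x v v) ∧
              ENNReal.ofReal ((1 - δ) * (8 * Real.pi ^ 2 / 3)) ≤ riemannianMeasure h' Set.univ := by
  sorry

/-! ## The composition: the three stubs prove the crux BY NAME (no `sorry` below this line) -/

/-- **Composition with explicit hypotheses** (the BC3 shape `stub₁-sig → stub₂-sig → stub₃-sig →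
crux`): split the homotopy sphere as `M = 𝔻⁴ ∪_φ Δ` (stub 1), equip `Δ` with its Borel σ-algebra,
note `∂Δ ≅ S³` through `φ⁻¹`, and hand the near-extremal admissible fill-ins of stub 2 at
`ρ₀ = π/4` to the cap-gluing stub 3. [cite: Perelman1997BigVolume, §4] -/
theorem RicciFatSphere_of_stubSigs
    (h₁ : ∀ (M : Type) [TopologicalSpace M] [T2Space M] [SecondCountableTopology M]
      [ChartedSpace (EuclideanSpace ℝ (Fin 4)) M] [IsManifold (𝓡 4) ∞ M] [CompactSpace M],
      M ≃ₕ Metric.sphere (0 : EuclideanSpace ℝ (Fin 5)) 1 →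
        ∃ (Δ : Type) (_ : TopologicalSpace Δ) (_ : T2Space Δ) (_ : SecondCountableTopology Δ)
          (_ : ChartedSpace (EuclideanHalfSpace 4) Δ) (_ : IsManifold (𝓡∂ 4) ∞ Δ)
          (b : BoundaryData (𝓡∂ 4) Δ (𝓡 3))
          (φ : (closedBallBoundaryData 3).carrier ≃ₘ⟮𝓡 3, 𝓡 3⟯ b.carrier),
          CompactSpace Δ ∧ ContractibleSpace Δ ∧
            IsBoundaryGluing (closedBallBoundaryData 3) b φ (𝓡 4) M)
    (h₂ : ∀ (Δ : Type) [TopologicalSpace Δ] [T2Space Δ] [SecondCountableTopology Δ]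
      [ChartedSpace (EuclideanHalfSpace 4) Δ] [IsManifold (𝓡∂ 4) ∞ Δ] [CompactSpace Δ]
      [ContractibleSpace Δ] [MeasurableSpace Δ] [BorelSpace Δ]
      (b : BoundaryData (𝓡∂ 4) Δ (𝓡 3)),
      Nonempty (b.carrier ≃ₘ⟮𝓡 3, 𝓡 3⟯ Metric.sphere (0 : EuclideanSpace ℝ (Fin 4)) 1) →
      ∀ ρ₀ : ℝ, 0 < ρ₀ → ρ₀ < Real.pi / 2 → ∀ ε : ℝ, 0 < ε →
        ∃ h : Bundle.ContMDiffRiemannianMetric (𝓡∂ 4) ∞ (EuclideanSpace ℝ (Fin 4))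
            (TangentSpace (𝓡∂ 4) : Δ → Type _),
          ∃ _ : (PseudoRiemannianMetric.ofRiemannian h).HasLeviCivita,
            HasRicciLowerBound (PseudoRiemannianMetric.ofRiemannian h) 3 ∧
            IsAdmissibleFillIn (PseudoRiemannianMetric.ofRiemannian h) b (Real.sin ρ₀) (-Real.cot ρ₀) ∧
            ENNReal.ofReal (2 * Real.pi ^ 2 * (2 / 3 + Real.cos ρ₀ - Real.cos ρ₀ ^ 3 / 3) - ε) ≤
              riemannianMeasure h Set.univ)
    (h₃ : ∀ (M : Type) [TopologicalSpace M] [T2Space M] [SecondCountableTopology M]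
      [ChartedSpace (EuclideanSpace ℝ (Fin 4)) M] [IsManifold (𝓡 4) ∞ M] [CompactSpace M]
      [MeasurableSpace M] [BorelSpace M]
      (Δ : Type) [TopologicalSpace Δ] [T2Space Δ] [SecondCountableTopology Δ]
      [ChartedSpace (EuclideanHalfSpace 4) Δ] [IsManifold (𝓡∂ 4) ∞ Δ] [CompactSpace Δ]
      [MeasurableSpace Δ] [BorelSpace Δ]
      (b : BoundaryData (𝓡∂ 4) Δ (𝓡 3))
      (φ : (closedBallBoundaryData 3).carrier ≃ₘ⟮𝓡 3, 𝓡 3⟯ b.carrier),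
      IsBoundaryGluing (closedBallBoundaryData 3) b φ (𝓡 4) M →
      ∀ ρ₀ : ℝ, 0 < ρ₀ → ρ₀ < Real.pi / 2 →
        (∀ ε : ℝ, 0 < ε →
          ∃ h : Bundle.ContMDiffRiemannianMetric (𝓡∂ 4) ∞ (EuclideanSpace ℝ (Fin 4))
              (TangentSpace (𝓡∂ 4) : Δ → Type _),
            ∃ _ : (PseudoRiemannianMetric.ofRiemannian h).HasLeviCivita,
              HasRicciLowerBound (PseudoRiemannianMetric.ofRiemannian h) 3 ∧
              IsAdmissibleFillIn (PseudoRiemannianMetric.ofRiemannian h) b (Real.sin ρ₀) (-Real.cot ρ₀) ∧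
              ENNReal.ofReal (2 * Real.pi ^ 2 * (2 / 3 + Real.cos ρ₀ - Real.cos ρ₀ ^ 3 / 3) - ε) ≤
                riemannianMeasure h Set.univ) →
        ∀ δ : ℝ, 0 < δ →
          ∃ h' : Bundle.ContMDiffRiemannianMetric (𝓡 4) ∞ (EuclideanSpace ℝ (Fin 4))
              (TangentSpace (𝓡 4) : M → Type _),
            ∃ _ : (PseudoRiemannianMetric.ofRiemannian h').HasLeviCivita,
              (∀ (x : M) (v : TangentSpace (𝓡 4) x),
                3 * h'.inner x v v ≤ (PseudoRiemannianMetric.ofRiemannian h').ricci x v v) ∧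
              ENNReal.ofReal ((1 - δ) * (8 * Real.pi ^ 2 / 3)) ≤ riemannianMeasure h' Set.univ) :
    RicciFatSphere := by
  intro M _ _ _ _ _ _ _ _ e δ hδ
  -- stub 1: `M = 𝔻⁴ ∪_φ Δ` with `Δ` compact contractible
  obtain ⟨Δ, _, _, _, _, _, b, φ, hΔc, hΔk, hglue⟩ := h₁ M e
  haveI : CompactSpace Δ := hΔc
  haveI : ContractibleSpace Δ := hΔk
  -- the Borel σ-algebra of `Δ` feeds `riemannianMeasure`
  letI : MeasurableSpace Δ := borel Δ
  haveI : BorelSpace Δ := ⟨rfl⟩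
  -- `∂Δ ≅ ∂𝔻⁴ = S³` through the gluing diffeomorphism
  have hS : Nonempty (b.carrier ≃ₘ⟮𝓡 3, 𝓡 3⟯ Metric.sphere (0 : EuclideanSpace ℝ (Fin 4)) 1) :=
    ⟨φ.symm⟩
  -- `ρ₀ = π/4 ∈ (0, π/2)`
  have hρ₀ : (0 : ℝ) < Real.pi / 4 := by positivity
  have hρ₁ : Real.pi / 4 < Real.pi / 2 := by linarith [Real.pi_pos]
  -- stub 3 fed with the near-extremal fill-ins of stub 2
  exact h₃ M Δ b φ hglue (Real.pi / 4) hρ₀ hρ₁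
    (fun ε hε => h₂ Δ b hS (Real.pi / 4) hρ₀ hρ₁ ε hε) δ hδ

/-- **THE SKELETON THEOREM.** The crux
`Summit.SmoothPoincare4.SmoothPoincare4.Theses.RicciFat.RicciFatSphere`, concluded BY NAME from the
three DECLARED stubs `stub_ballSplitting`, `stub_ricciFatBall`, `stub_capGluing` (the only `sorry`s of
the file) through the sorry-free composition `RicciFatSphere_of_stubSigs`.
[cite: Perelman1997BigVolume, §4] -/
theorem RicciFatSphere_of : RicciFatSphere :=
  RicciFatSphere_of_stubSigs stub_ballSplitting stub_ricciFatBall stub_capGluing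

end Summit.SmoothPoincare4.SmoothPoincare4.Cruxes.RicciFatSphere.Birth

end
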